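import Literature.Analysis.FluidPDE.HardSphereCollisionRecord
import HarnessLib

/-!
# Collision records: the measurable structure

Companion to `Literature.Analysis.FluidPDE.HardSphereCollisionRecord`, which DEFINES the record
`HardSphereCollisionRecord d X N` of one collision of `N` hard spheres (time, ordered pair,
positions, impact vector `ω = ε⁻¹ (x_i - x_j)`, pre- and post-collisional velocities;
Gallagher–Saint-Raymond–Texier 2013 §4.1), the record `HardSphereCollisionRecord.ofConfig G ε z t i j`
read off a configuration, and the collision sums `collisionSum G ε γ S F` /
`HardSphereFlow.collisionSum Φ S F z` of a functional `F` of the record. Route statements speak of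
collision sums "for measurable `F` of the record" and of conditional laws of marks of the record
(impact vector, outgoing direction) given a coarse past; for `Measurable F` to typecheck the record
type needs a `MeasurableSpace` structure, which this file provides — the product structure
transported along the tuple form of a record — together with the measurability API:

* `HardSphereCollisionRecord.Tuple d X N` — the product type
  `ℝ × (Fin N × Fin N) × (X × X) × ℝ^d × (ℝ^d × ℝ^d) × (ℝ^d × ℝ^d)` and the bijection
  `HardSphereCollisionRecord.equivTuple` (`toTuple`/`ofTuple`);
* `HardSphereCollisionRecord.instMeasurableSpace` — `MeasurableSpace.comap equivTuple` of the
  product σ-algebra (Borel on `ℝ`, `ℝ^d`; discrete on `Fin N`; the given one on `X`);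
  `measurableEquivTuple : HardSphereCollisionRecord d X N ≃ᵐ Tuple d X N`;
  `measurable_iff_tuple` (a record-valued map is measurable iff its tuple form is);
* measurability of the fields and marks: `measurable_time`, `measurable_indices`,
  `measurable_positions`, `measurable_fstPos`, `measurable_sndPos`, `measurable_impactVec`,
  `measurable_preVel`, `measurable_postVel`, `measurable_mark`, `measurable_outDir`,
  `measurable_inDir`; the constructor `Measurable.hardSphereCollisionRecord_mk`;
* `HardSphereCollisionRecord.measurable_ofConfig` / `measurable_ofConfig₂`: for a geometry with
  jointly measurable separation map (`ℝ^d`, `T^d`), `z ↦ ofConfig G ε z t i j` and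
  `(t, z) ↦ ofConfig G ε z t i j` are measurable — so that, composed with a (jointly) measurable
  flow and measurable collision times, records along the flow are measurable functions of the
  initial datum.

## Mathlib / Literature reuse

`MeasurableSpace.comap`, `MeasurableSpace.comap_comp`, `measurable_iff_comap_le`,
`comap_measurable`, `MeasurableEquiv`, the `WithLp`/`PiLp` measurable structure of
`EuclideanSpace` (`Mathlib.Analysis.Normed.Lp.MeasurableSpace`), `Measurable.inner/norm/smul`
are Mathlib's; the record, `ofConfig`, `mark`, `outDir`, `inDir`, `reflectVel`, `Geometry.sepVec`
are the record file's / `HardSpherePhaseSpace`'s. The pattern (σ-algebra of a structure =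
comap along its tuple equivalence) is Mathlib's own for type synonyms (`WithLp.measurableSpace`).

## Design choices

* Only a measurable structure, no topology/`BorelSpace` on records: marks that are integrated
  against (`mark`, `outDir`) live in standard Borel spaces already, and the collision measure of
  the record file is a measure on the mark space; what routes need on the record type itself is
  to say `Measurable F`.
* The separation map enters `measurable_ofConfig` through the raw hypothesis
  `Measurable fun q : X × X => G.sepVec q.1 q.2` (as in `measurableSet_contactSet`), not through
  `Geometry.IsMeasurable` of `HardSphereFlowMeasurable`, to keep the imports of this file at the
  level of the record file.
* Deliberately NOT here: measurability in the initial datum of `HardSphereFlow.nthRecordOf` /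
  `HardSphereFlow.collisionSum` (needs joint measurability of the flow and of the collision
  times in the datum — route / flow-construction business, cf. `HardSphereFlowJointMeasurable`).

## References

* I. Gallagher, L. Saint-Raymond, B. Texier, *From Newton to Boltzmann: hard spheres and
  short-range potentials*, EMS (2013), §4.1 (collisions of the hard-sphere flow: time, pair,
  impact direction, incoming/outgoing velocities).
-/

open Set Function MeasureTheory

namespace Literature.Analysis.FluidPDE

noncomputable section

namespace HardSphereCollisionRecord

variable {d : Type*} {X : Type*} {N : ℕ}

/-! ## The tuple form of a record -/

/-- The product type carrying the tuple form of a collision record: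
`(t, (i, j), (x_i, x_j), ω, (v_i⁻, v_j⁻), (v_i⁺, v_j⁺))`. [folklore] -/
abbrev Tuple (d : Type*) (X : Type*) (N : ℕ) : Type _ :=
  ℝ × (Fin N × Fin N) × (X × X) × EuclideanSpace ℝ d ×
    (EuclideanSpace ℝ d × EuclideanSpace ℝ d) × (EuclideanSpace ℝ d × EuclideanSpace ℝ d)

/-- The tuple form `(t, (i, j), (x_i, x_j), ω, (v_i⁻, v_j⁻), (v_i⁺, v_j⁺))` of a record. [folklore] -/
def toTuple (c : HardSphereCollisionRecord d X N) : Tuple d X N :=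
  (c.time, (c.fst, c.snd), (c.fstPos, c.sndPos), c.impactVec, c.preVel, c.postVel)

/-- The record with a given tuple form. [folklore] -/
def ofTuple (p : Tuple d X N) : HardSphereCollisionRecord d X N :=
  ⟨p.1, p.2.1.1, p.2.1.2, p.2.2.1.1, p.2.2.1.2, p.2.2.2.1, p.2.2.2.2.1, p.2.2.2.2.2⟩

/-- **Records are tuples**: the bijection between collision records and their tuple forms.
[folklore] -/
def equivTuple : HardSphereCollisionRecord d X N ≃ Tuple d X N where
  toFun := toTuple
  invFun := ofTuple
  left_inv _ := rfl
  right_inv _ := rfl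

/-- Unfolding lemma for the tuple form. [folklore] -/
@[simp]
theorem equivTuple_apply (c : HardSphereCollisionRecord d X N) :
    equivTuple c = (c.time, (c.fst, c.snd), (c.fstPos, c.sndPos), c.impactVec, c.preVel, c.postVel) :=
  rfl

/-- Unfolding lemma for the inverse of the tuple form. [folklore] -/
@[simp]
theorem equivTuple_symm_apply (p : Tuple d X N) :
    equivTuple.symm p =
      (⟨p.1, p.2.1.1, p.2.1.2, p.2.2.1.1, p.2.2.1.2, p.2.2.2.1, p.2.2.2.2.1, p.2.2.2.2.2⟩ :
        HardSphereCollisionRecord d X N) :=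
  rfl

/-! ## The measurable structure -/

/-- **The σ-algebra of collision records**: the product σ-algebra (Borel on the time, the impact
vector and the velocities, discrete on the particle labels, the given one on positions)
transported along the tuple form. [folklore] -/
instance instMeasurableSpace [MeasurableSpace X] : MeasurableSpace (HardSphereCollisionRecord d X N) :=
  MeasurableSpace.comap equivTuple inferInstance

variable [MeasurableSpace X]

/-- The tuple form is measurable (by construction). [folklore] -/
theorem measurable_equivTuple :
    Measurable (equivTuple : HardSphereCollisionRecord d X N → Tuple d X N) :=
  comap_measurable _

/-- **A record-valued map is measurable iff its tuple form is.** [folklore] -/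
theorem measurable_iff_tuple {α : Type*} [MeasurableSpace α]
    {f : α → HardSphereCollisionRecord d X N} :
    Measurable f ↔ Measurable (equivTuple ∘ f) := by
  rw [measurable_iff_comap_le, measurable_iff_comap_le, instMeasurableSpace,
    MeasurableSpace.comap_comp]

/-- The inverse of the tuple form is measurable. [folklore] -/
theorem measurable_equivTuple_symm :
    Measurable (equivTuple.symm : Tuple d X N → HardSphereCollisionRecord d X N) :=
  measurable_iff_tuple.2 (by rw [Equiv.self_comp_symm]; exact measurable_id)

/-- **Records are tuples, measurably**: the tuple form as a measurable equivalence. [folklore] -/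
def measurableEquivTuple : HardSphereCollisionRecord d X N ≃ᵐ Tuple d X N where
  toEquiv := equivTuple
  measurable_toFun := measurable_equivTuple
  measurable_invFun := measurable_equivTuple_symm

/-- The measurable equivalence is the tuple form. [folklore] -/
@[simp]
theorem coe_measurableEquivTuple :
    ⇑(measurableEquivTuple : HardSphereCollisionRecord d X N ≃ᵐ Tuple d X N) = equivTuple :=
  rfl

/-- **Building measurable record-valued maps**: a map into records all of whose fields are
measurable functions is measurable. Deliberately declared in Mathlib's `Measurable` namespace, as a
dot-notation extension (`ht.hardSphereCollisionRecord_mk hi hj …`, like `Measurable.prodMk`).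
[folklore] -/
theorem _root_.Measurable.hardSphereCollisionRecord_mk {α : Type*} [MeasurableSpace α]
    {t : α → ℝ} {i j : α → Fin N} {x y : α → X} {ω : α → EuclideanSpace ℝ d}
    {u w : α → EuclideanSpace ℝ d × EuclideanSpace ℝ d} (ht : Measurable t) (hi : Measurable i)
    (hj : Measurable j) (hx : Measurable x) (hy : Measurable y) (hω : Measurable ω)
    (hu : Measurable u) (hw : Measurable w) :
    Measurable fun a => (⟨t a, i a, j a, x a, y a, ω a, u a, w a⟩ : HardSphereCollisionRecord d X N) :=
  measurable_iff_tuple.2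
    (ht.prodMk ((hi.prodMk hj).prodMk ((hx.prodMk hy).prodMk (hω.prodMk (hu.prodMk hw)))))

/-! ## Measurability of the fields and of the marks -/

/-- The collision time is a measurable function of the record. [folklore] -/
theorem measurable_time : Measurable fun c : HardSphereCollisionRecord d X N => c.time :=
  measurable_fst.comp measurable_equivTuple

/-- The ordered colliding pair is a measurable function of the record. [folklore] -/
theorem measurable_indices : Measurable fun c : HardSphereCollisionRecord d X N => (c.fst, c.snd) :=
  measurable_snd.fst.comp measurable_equivTuple

/-- The pair of positions is a measurable function of the record. [folklore] -/
theorem measurable_positions :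
    Measurable fun c : HardSphereCollisionRecord d X N => (c.fstPos, c.sndPos) :=
  measurable_snd.snd.fst.comp measurable_equivTuple

/-- The position of the first particle is a measurable function of the record. [folklore] -/
theorem measurable_fstPos : Measurable fun c : HardSphereCollisionRecord d X N => c.fstPos :=
  measurable_positions.fst

/-- The position of the second particle is a measurable function of the record. [folklore] -/
theorem measurable_sndPos : Measurable fun c : HardSphereCollisionRecord d X N => c.sndPos :=
  measurable_positions.snd

/-- The impact vector is a measurable function of the record. [folklore] -/
theorem measurable_impactVec : Measurable fun c : HardSphereCollisionRecord d X N => c.impactVec :=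
  measurable_snd.snd.snd.fst.comp measurable_equivTuple

/-- The pre-collisional velocities are a measurable function of the record. [folklore] -/
theorem measurable_preVel : Measurable fun c : HardSphereCollisionRecord d X N => c.preVel :=
  measurable_snd.snd.snd.snd.fst.comp measurable_equivTuple

/-- The post-collisional velocities are a measurable function of the record. [folklore] -/
theorem measurable_postVel : Measurable fun c : HardSphereCollisionRecord d X N => c.postVel :=
  measurable_snd.snd.snd.snd.snd.comp measurable_equivTuple

/-- The mark `(t, x_fst, ω, v_fst⁻, v_snd⁻)` is a measurable function of the record. [folklore] -/
theorem measurable_mark : Measurable fun c : HardSphereCollisionRecord d X N => c.mark :=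
  measurable_time.prodMk (measurable_fstPos.prodMk (measurable_impactVec.prodMk
    (measurable_preVel.fst.prodMk measurable_preVel.snd)))

variable [Fintype d]

/-- The outgoing relative direction `ĝ_out` is a measurable function of the record. [folklore] -/
theorem measurable_outDir : Measurable fun c : HardSphereCollisionRecord d X N => c.outDir := by
  have h : Measurable fun c : HardSphereCollisionRecord d X N => c.postVel.1 - c.postVel.2 :=
    measurable_postVel.fst.sub measurable_postVel.snd
  exact h.norm.inv.smul h

/-- The incoming relative direction `ĝ_in` is a measurable function of the record. [folklore] -/
theorem measurable_inDir : Measurable fun c : HardSphereCollisionRecord d X N => c.inDir := by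
  have h : Measurable fun c : HardSphereCollisionRecord d X N => c.preVel.1 - c.preVel.2 :=
    measurable_preVel.fst.sub measurable_preVel.snd
  exact h.norm.inv.smul h

/-! ## Measurability of the record read off a configuration -/

/-- **The record of `(i, j)` at time `t` is a jointly measurable function of the time and the
configuration**, for a geometry whose separation map is jointly measurable
(`Euclidean.measurable_geometry_sepVec`, `Torus.measurable_geometry_sepVec`). [folklore] -/
theorem measurable_ofConfig₂ {G : Geometry d X} (hG : Measurable fun q : X × X => G.sepVec q.1 q.2)
    (ε : ℝ) (i j : Fin N) :
    Measurable fun p : ℝ × Config N d X => ofConfig G ε p.2 p.1 i j := by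
  -- the elastic reflection law is jointly measurable in (impact direction, velocities)
  have hrefl : Measurable fun q : EuclideanSpace ℝ d × (EuclideanSpace ℝ d × EuclideanSpace ℝ d) =>
      reflectVel q.1 q.2 := by
    have hc : Measurable fun q : EuclideanSpace ℝ d × (EuclideanSpace ℝ d × EuclideanSpace ℝ d) =>
        inner ℝ (q.2.1 - q.2.2) q.1 / ‖q.1‖ ^ 2 :=
      ((measurable_snd.fst.sub measurable_snd.snd).inner measurable_fst).div
        (measurable_fst.norm.pow_const 2)
    unfold reflectVel
    exact (measurable_snd.fst.sub (hc.smul measurable_fst)).prodMk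
      (measurable_snd.snd.add (hc.smul measurable_fst))
  have hzi : Measurable fun p : ℝ × Config N d X => p.2 i := (measurable_pi_apply i).comp measurable_snd
  have hzj : Measurable fun p : ℝ × Config N d X => p.2 j := (measurable_pi_apply j).comp measurable_snd
  have hsep : Measurable fun p : ℝ × Config N d X => G.sepVec (p.2 i).1 (p.2 j).1 :=
    hG.comp (hzi.fst.prodMk hzj.fst)
  exact measurable_fst.hardSphereCollisionRecord_mk measurable_const measurable_const hzi.fst
    hzj.fst (hsep.const_smul ε⁻¹) (hrefl.comp (hsep.prodMk (hzi.snd.prodMk hzj.snd)))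
    (hzi.snd.prodMk hzj.snd)

/-- **The record of `(i, j)` at time `t` is a measurable function of the configuration**, for a
geometry whose separation map is jointly measurable. [folklore] -/
theorem measurable_ofConfig {G : Geometry d X} (hG : Measurable fun q : X × X => G.sepVec q.1 q.2)
    (ε : ℝ) (t : ℝ) (i j : Fin N) :
    Measurable fun z : Config N d X => ofConfig G ε z t i j :=
  (measurable_ofConfig₂ hG ε i j).comp (measurable_const.prodMk measurable_id)

/-- For the Euclidean geometry the record is a jointly measurable function of time and
configuration. [folklore] -/
theorem measurable_ofConfig₂_euclidean (ε : ℝ) (i j : Fin N) :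
    Measurable fun p : ℝ × Config N d (EuclideanSpace ℝ d) =>
      ofConfig (Euclidean.geometry d) ε p.2 p.1 i j :=
  measurable_ofConfig₂ Euclidean.measurable_geometry_sepVec ε i j

/-- For the flat torus the record is a jointly measurable function of time and configuration.
[folklore] -/
theorem measurable_ofConfig₂_torus (ε : ℝ) (i j : Fin N) :
    Measurable fun p : ℝ × Config N d (UnitAddTorus d) => ofConfig (Torus.geometry d) ε p.2 p.1 i j :=
  measurable_ofConfig₂ Torus.measurable_geometry_sepVec ε i j

end HardSphereCollisionRecord

end

end Literature.Analysis.FluidPDE
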